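import Summits.RiemannHypothesis.RiemannHypothesis.Theses.WeilParity
import Summits.RiemannHypothesis.RiemannHypothesis.Theorems.WeilRouteProps.WeilParity

/-!
# `Iff.rfl` bridges: Theses-free copies ↔ route propositions (route `WeilParity`)

LEAF module (imports the route file; nothing imports this): for every statement item `X` of route `WeilParity` the copy
`Summit.RiemannHypothesis.RiemannHypothesis.Theorems.WeilRouteProps.WeilParity.X` and the route declaration
`Summit.RiemannHypothesis.RiemannHypothesis.Theses.WeilParity.X` are the same proposition, by `Iff.rfl` (definitional unfolding).
If a route statement is ever restated, this file stops elaborating — the signal to re-sync the copy. Build refactor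
(21-frontier 2026-08-26T18:52:29Z); nothing here bears on the truth of RH.
-/

namespace Summit.RiemannHypothesis.RiemannHypothesis.Theorems.WeilRouteProps.WeilParity

/-- The Theses-free copy `WeilRouteProps.WeilParity.EvenSectorWins` IS the route proposition `Theses.WeilParity.EvenSectorWins` (item stmt-RiemannHypothesis-15430):
definitional unfolding (`Iff.rfl`). -/
theorem EvenSectorWins_iff :
    EvenSectorWins ↔ Summit.RiemannHypothesis.RiemannHypothesis.Theses.WeilParity.EvenSectorWins :=
  Iff.rfl

/-- The Theses-free copy `WeilRouteProps.WeilParity.OffLineParityDetection` IS the route proposition `Theses.WeilParity.OffLineParityDetection` (item stmt-RiemannHypothesis-15431):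
definitional unfolding (`Iff.rfl`). -/
theorem OffLineParityDetection_iff :
    OffLineParityDetection ↔ Summit.RiemannHypothesis.RiemannHypothesis.Theses.WeilParity.OffLineParityDetection :=
  Iff.rfl

/-- The Theses-free copy `WeilRouteProps.WeilParity.EvenWinsBeyondArch` IS the route proposition `Theses.WeilParity.EvenWinsBeyondArch` (item stmt-RiemannHypothesis-15432):
definitional unfolding (`Iff.rfl`). -/
theorem EvenWinsBeyondArch_iff :
    EvenWinsBeyondArch ↔ Summit.RiemannHypothesis.RiemannHypothesis.Theses.WeilParity.EvenWinsBeyondArch :=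
  Iff.rfl

/-- The Theses-free copy `WeilRouteProps.WeilParity.EvenWinsArch` IS the route proposition `Theses.WeilParity.EvenWinsArch` (item stmt-RiemannHypothesis-15433):
definitional unfolding (`Iff.rfl`). -/
theorem EvenWinsArch_iff :
    EvenWinsArch ↔ Summit.RiemannHypothesis.RiemannHypothesis.Theses.WeilParity.EvenWinsArch :=
  Iff.rfl

/-- The Theses-free copy `WeilRouteProps.WeilParity.OnePrimeWindowSimpleEven` IS the route proposition `Theses.WeilParity.OnePrimeWindowSimpleEven` (item stmt-RiemannHypothesis-18084):
definitional unfolding (`Iff.rfl`). -/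
theorem OnePrimeWindowSimpleEven_iff :
    OnePrimeWindowSimpleEven ↔ Summit.RiemannHypothesis.RiemannHypothesis.Theses.WeilParity.OnePrimeWindowSimpleEven :=
  Iff.rfl

/-- The Theses-free copy `WeilRouteProps.WeilParity.NoParityCrossing` IS the route proposition `Theses.WeilParity.NoParityCrossing` (item stmt-RiemannHypothesis-18085):
definitional unfolding (`Iff.rfl`). -/
theorem NoParityCrossing_iff :
    NoParityCrossing ↔ Summit.RiemannHypothesis.RiemannHypothesis.Theses.WeilParity.NoParityCrossing :=
  Iff.rfl

/-- The Theses-free copy `WeilRouteProps.WeilParity.ParityGlue` IS the route proposition `Theses.WeilParity.ParityGlue` (item stmt-RiemannHypothesis-15434):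
definitional unfolding (`Iff.rfl`). -/
theorem ParityGlue_iff :
    ParityGlue ↔ Summit.RiemannHypothesis.RiemannHypothesis.Theses.WeilParity.ParityGlue :=
  Iff.rfl

/-- The Theses-free copy `WeilRouteProps.WeilParity.FiniteDefectParityAlternation` IS the route proposition `Theses.WeilParity.FiniteDefectParityAlternation` (item stmt-RiemannHypothesis-15435):
definitional unfolding (`Iff.rfl`). -/
theorem FiniteDefectParityAlternation_iff :
    FiniteDefectParityAlternation ↔ Summit.RiemannHypothesis.RiemannHypothesis.Theses.WeilParity.FiniteDefectParityAlternation :=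
  Iff.rfl

/-- The Theses-free copy `WeilRouteProps.WeilParity.RHImpliesEvenWins` IS the route proposition `Theses.WeilParity.RHImpliesEvenWins` (item stmt-RiemannHypothesis-15436):
definitional unfolding (`Iff.rfl`). -/
theorem RHImpliesEvenWins_iff :
    RHImpliesEvenWins ↔ Summit.RiemannHypothesis.RiemannHypothesis.Theses.WeilParity.RHImpliesEvenWins :=
  Iff.rfl

/-- The Theses-free copy `WeilRouteProps.WeilParity.EvenWinsBeyondArchOfPieces` IS the route proposition `Theses.WeilParity.EvenWinsBeyondArchOfPieces` (item stmt-RiemannHypothesis-17975):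
definitional unfolding (`Iff.rfl`). -/
theorem EvenWinsBeyondArchOfPieces_iff :
    EvenWinsBeyondArchOfPieces ↔ Summit.RiemannHypothesis.RiemannHypothesis.Theses.WeilParity.EvenWinsBeyondArchOfPieces :=
  Iff.rfl

/-- The Theses-free copy `WeilRouteProps.WeilParity.Assembly` IS the route proposition `Theses.WeilParity.Assembly` (item stmt-RiemannHypothesis-15437):
definitional unfolding (`Iff.rfl`). -/
theorem Assembly_iff :
    Assembly ↔ Summit.RiemannHypothesis.RiemannHypothesis.Theses.WeilParity.Assembly :=
  Iff.rfl

end Summit.RiemannHypothesis.RiemannHypothesis.Theorems.WeilRouteProps.WeilParity
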